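import Literature.NumberTheory.Automorphic.ShimuraCurveLocalUnitNorms
import Literature.NumberTheory.Automorphic.BrandtXi
import Literature.NumberTheory.Automorphic.BrandtModuleDictionary
import Literature.NumberTheory.Automorphic.DefiniteMaximalOrdersLeftOrderFibres
import Literature.NumberTheory.Automorphic.DefiniteOrderUnitsFinite
import Literature.NumberTheory.Automorphic.BrandtMatrixThetaSeries
import Literature.NumberTheory.Automorphic.BrandtThetaSeriesClassFunction
import Literature.NumberTheory.ModularForms.SiegelThetaMultiplierGaussSum
import Literature.NumberTheory.ModularForms.SiegelThetaMultiplierCyclotomic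
import Literature.NumberTheory.EllipticCurves.ModularFormsGamma0Genus
import Mathlib.NumberTheory.ModularForms.CuspFormSubmodule
import Mathlib.LinearAlgebra.Matrix.ToLin
import Literature.NumberTheory.Automorphic.BrandtSetupAdmissible
import HarnessLib
import Literature.NumberTheory.Automorphic.BrandtThetaSeriesHeckeAction
import Literature.NumberTheory.Automorphic.BrandtHeckeProjector
import Literature.NumberTheory.Automorphic.BrandtEigenvectorDegreeZero
import Literature.NumberTheory.Automorphic.EichlerSubidealCount
import Literature.NumberTheory.EllipticCurves.CongruenceNumber
import Literature.NumberTheory.EllipticCurves.HeckeCongruenceModulus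
import Literature.NumberTheory.EllipticCurves.NewformsMultiplicityOneProofs
import Literature.NumberTheory.EllipticCurves.NewformsHeckeProofs
import Literature.NumberTheory.EllipticCurves.NewformsRealCoefficients
import Summits.ABC.ABC.Theses.DefiniteXi
import Literature.NumberTheory.Automorphic.BrandtEigenvectorNonEisenstein
import Literature.NumberTheory.Automorphic.BrandtXiSetupIndependence
import Literature.NumberTheory.EllipticCurves.PastenSpectralDegreeProofs
import Literature.NumberTheory.EllipticCurves.PastenCongruenceModulusProofs
import Literature.NumberTheory.EllipticCurves.ModularDegreeMinimal
import Literature.NumberTheory.EllipticCurves.ModularCurveManinSemistableBridgeProofs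
import Literature.NumberTheory.EllipticCurves.SzpiroFreyConductorProofs
import Literature.NumberTheory.Automorphic.ShimuraCurveRibetTakahashiCokernelProofs
import Literature.NumberTheory.EllipticCurves.PastenValuationProductThm75MultiplicityProofs

/-!
# Xi helper 3 — Brandt theta series at the cusps: Gram matrix, symplectic bookkeeping, the cusp path (k1 G8, first part)

Helper module 3/10 for the registered stub `stub_xiDegreeComparison` of the line `p6_tamagawa_split` (crux `DefiniteXi.SteinbergCore`, item stmt-ABC-15024, route `route-ABC-DefiniteXi`).  Content = lines 719–947, 1242–1252 of `Summits/ABC/ABC/Cruxes/SteinbergCore/STUB_PLAN_stub_xiDegreeComparison_XiMono.lean` (the renamespaced k1 gen-11 certificate `STUB_IDEAS_stub_xiDegreeComparison_1_g11_Certificate.lean`: k1 gens 7–11, k2 gen-4 kernel, k3 gen-4 tail — authors: stub-ideation seats k1/k2/k3), cut mechanically at declaration boundaries by the stub-critic (plan `STUB-PLAN-stub_xiDegreeComparison.md` §1).  Proofs verbatim; nothing restated.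
-/

set_option linter.dupNamespace false

noncomputable section

namespace Summit.ABC.ABC.Theorems.SteinbergCoreXi.StubIdeasK1G8

open Complex hiding I
open Matrix Filter Topology ModularForm
open Complex (I)
open scoped MatrixGroups UpperHalfPlane

open Literature.NumberTheory.ModularForms
open Literature.NumberTheory.ModularForms.SiegelModularForm (one1 one1_map one1_mul one1_inv smul_one1 det_one1
  one1_injective eq_one1 spOfSL spOfSL_mem moeb_spOfSL det_denom_spOfSL num_denom_spOfSL)
open Literature.NumberTheory.EllipticCurves.ModularForms
open Literature.NumberTheory.Automorphic Literature.NumberTheory.Automorphic.Brandt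

/-! ## §0 Dictionary (gen 5/6) and the facts about `[T_ij]` the E-block consumes -/

variable {Nplus Nminus : ℕ} (S : XiSetup Nplus Nminus)

/-- The Gram matrix `[T_{ij}]` behind `S.brandtTheta i j`. -/
def brandtGram (i j : ClassSet S.O) : Matrix (Fin 4) (Fin 4) ℤ :=
  normFormGram (S.nonempty_basis_transporterLeft i.rep_mem j.rep_mem).some (S.nrdGen j.rep_mem / S.nrdGen i.rep_mem)

/-- Unfolding of the Brandt theta series `Θ_ij(τ)` of the setup `S` as the exponential sum over the transporter lattice `I_j I_i⁻¹` weighted by the normalised reduced norm (gen-6 E0, bookkeeping). -/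
theorem brandtTheta_apply (i j : ClassSet S.O) (τ : ℍ) :
    S.brandtTheta i j τ = siegelThetaSeries (brandtGram S i j) (one1 (τ : ℂ)) := rfl

/-- The Gram identity `⌊trd(b_r b̄_s)/q⌋ · q = trd(b_r b̄_s)` for the basis behind `brandtGram`. -/
theorem cast_brandtGram_mul (i j : ClassSet S.O) (r s : Fin 4) :
    ((brandtGram S i j r s : ℤ) : ℚ) * (S.nrdGen j.rep_mem / S.nrdGen i.rep_mem) =
      reducedTrace ℚ S.D (((S.nonempty_basis_transporterLeft i.rep_mem j.rep_mem).some r : S.D) *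
        standardInvolution ℚ S.D ((S.nonempty_basis_transporterLeft i.rep_mem j.rep_mem).some s : S.D)) :=
  (S.ofLeftOrder i.rep_mem).cast_normFormGram_mul (div_pos (S.nrdGen_pos j.rep_mem) (S.nrdGen_pos i.rep_mem)).ne'
    (S.nrdIdeal_transporterLeft j.rep_mem i.rep_mem (S.nrdGen_pos j.rep_mem) (S.nrdGen_pos i.rep_mem)
      (S.nrdIdeal_eq_span_nrdGen j.rep_mem) (S.nrdIdeal_eq_span_nrdGen i.rep_mem)) _ r s

/-- The Gram matrix of the normalised norm form on `I_j I_i⁻¹` has determinant `(N⁺N⁻)²` (level of the theta series; gen-6 E1). -/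
theorem det_brandtGram (i j : ClassSet S.O) : (brandtGram S i j).det = ((Nplus * Nminus : ℕ) : ℤ) ^ 2 :=
  (S.ofLeftOrder i.rep_mem).det_normFormGram (S.transporterLeft_mem_rightIdeals_leftOrder i.rep_mem j.rep_mem)
    (div_pos (S.nrdGen_pos j.rep_mem) (S.nrdGen_pos i.rep_mem))
    (S.nrdIdeal_transporterLeft j.rep_mem i.rep_mem (S.nrdGen_pos j.rep_mem) (S.nrdGen_pos i.rep_mem)
      (S.nrdIdeal_eq_span_nrdGen j.rep_mem) (S.nrdIdeal_eq_span_nrdGen i.rep_mem)) (cast_brandtGram_mul S i j)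

/-- NEW (proved). `[T_ij]` is symmetric. -/
theorem brandtGram_isSymm (i j : ClassSet S.O) : (brandtGram S i j).IsSymm :=
  isSymm_of_normFormGram (div_pos (S.nrdGen_pos j.rep_mem) (S.nrdGen_pos i.rep_mem)).ne' (cast_brandtGram_mul S i j)

/-- NEW (proved). `[T_ij]` is even. -/
theorem even_brandtGram_diag (i j : ClassSet S.O) (r : Fin 4) : Even (brandtGram S i j r r) :=
  (S.ofLeftOrder i.rep_mem).even_normFormGram_diag (div_pos (S.nrdGen_pos j.rep_mem) (S.nrdGen_pos i.rep_mem)).ne'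
    (S.nrdIdeal_transporterLeft j.rep_mem i.rep_mem (S.nrdGen_pos j.rep_mem) (S.nrdGen_pos i.rep_mem)
      (S.nrdIdeal_eq_span_nrdGen j.rep_mem) (S.nrdIdeal_eq_span_nrdGen i.rep_mem)) (cast_brandtGram_mul S i j) r

/-- NEW (proved). `[T_ij] > 0`. -/
theorem posDef_brandtGram (i j : ClassSet S.O) : ((brandtGram S i j).map ((↑) : ℤ → ℝ)).PosDef :=
  (S.ofLeftOrder i.rep_mem).posDef_normFormGram_map (S.transporterLeft_mem_rightIdeals_leftOrder i.rep_mem j.rep_mem).1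
    (div_pos (S.nrdGen_pos j.rep_mem) (S.nrdGen_pos i.rep_mem)) (cast_brandtGram_mul S i j)

/-- NEW (proved). The LEVEL DATUM of `[T_ij]`: `P·[T] = [T]·P = N⁺N⁻ · 1`, `P` even. -/
theorem exists_brandtGram_levelDatum (i j : ClassSet S.O) :
    ∃ P : Matrix (Fin 4) (Fin 4) ℤ, P * brandtGram S i j = ((Nplus * Nminus : ℕ) : ℤ) • (1 : Matrix (Fin 4) (Fin 4) ℤ) ∧
      brandtGram S i j * P = ((Nplus * Nminus : ℕ) : ℤ) • (1 : Matrix (Fin 4) (Fin 4) ℤ) ∧ ∀ r, Even (P r r) :=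
  (S.ofLeftOrder i.rep_mem).exists_normFormGram_levelDatum (S.transporterLeft_mem_rightIdeals_leftOrder i.rep_mem j.rep_mem)
    (div_pos (S.nrdGen_pos j.rep_mem) (S.nrdGen_pos i.rep_mem))
    (S.nrdIdeal_transporterLeft j.rep_mem i.rep_mem (S.nrdGen_pos j.rep_mem) (S.nrdGen_pos i.rep_mem)
      (S.nrdIdeal_eq_span_nrdGen j.rep_mem) (S.nrdIdeal_eq_span_nrdGen i.rep_mem)) (cast_brandtGram_mul S i j)

/-- Cusp constant of `θ_Q ∣ γ` (gen 5, verbatim): `d^{m/2}` at `c = 0`, else `(√det Q)⁻¹ (ic)^{−m/2} |c|^m G(a/c, Q)`. -/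
def thetaCuspValue {m : ℕ} (Q : Matrix (Fin m) (Fin m) ℤ) (γ : SL(2, ℤ)) : ℂ :=
  if γ 1 0 = 0 then ((γ 1 1 : ℤ) : ℂ) ^ (m / 2)
  else ((Real.sqrt ((Q.det : ℤ) : ℝ) : ℝ) : ℂ)⁻¹ * (I * ((γ 1 0 : ℤ) : ℂ)) ^ (-((m / 2 : ℕ) : ℤ)) *
      (((γ 1 0).natAbs : ℕ) : ℂ) ^ m *
        siegelGaussSum Q (γ 1 0).natAbs (one1 (((γ 0 0 : ℤ) : ℂ) / ((γ 1 0 : ℤ) : ℂ)))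

/-! ## §E0 The symplectic matrix `M = spOfSL (γ·S)` of the cusp path (all PROVED) -/

/-- Entries of `γ·S = (b, −a; d, −c)`. -/
theorem mul_S_apply (γ : SL(2, ℤ)) :
    (γ * ModularGroup.S) 0 0 = γ 0 1 ∧ (γ * ModularGroup.S) 0 1 = -(γ 0 0) ∧
      (γ * ModularGroup.S) 1 0 = γ 1 1 ∧ (γ * ModularGroup.S) 1 1 = -(γ 1 0) := by
  refine ⟨?_, ?_, ?_, ?_⟩ <;>
    simp [Matrix.SpecialLinearGroup.coe_mul, ModularGroup.coe_S, Matrix.mul_apply, Fin.sum_univ_two]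

/-- Blocks of `M = spOfSL (γ·S)`: `B = (−a)`, `C = (d)`, `D = (−c)`. -/
theorem toBlocks_spOfSL_mul_S (γ : SL(2, ℤ)) :
    (spOfSL (γ * ModularGroup.S)).toBlocks₁₂ = one1 (-(γ 0 0)) ∧ (spOfSL (γ * ModularGroup.S)).toBlocks₂₁ = one1 (γ 1 1) ∧
      (spOfSL (γ * ModularGroup.S)).toBlocks₂₂ = one1 (-(γ 1 0)) := by
  obtain ⟨-, h01, h10, h11⟩ := mul_S_apply γ
  refine ⟨?_, ?_, ?_⟩
  · rw [spOfSL, Matrix.toBlocks_fromBlocks₁₂, h01]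
  · rw [spOfSL, Matrix.toBlocks_fromBlocks₂₁, h10]
  · rw [spOfSL, Matrix.toBlocks_fromBlocks₂₂, h11]

/-- `det D = −c ≠ 0` off the cusp `∞`. -/
theorem det_toBlocks₂₂_spOfSL_mul_S (γ : SL(2, ℤ)) : (spOfSL (γ * ModularGroup.S)).toBlocks₂₂.det = -(γ 1 0) := by
  rw [(toBlocks_spOfSL_mul_S γ).2.2, det_one1]

/-- `d·BD⁻¹ = (a·sign c)` is integral for `d = |c|`. -/
theorem natAbs_smul_B_mul_inv_D (γ : SL(2, ℤ)) (hc : γ 1 0 ≠ 0) :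
    (((γ 1 0).natAbs : ℕ) : ℂ) • ((spOfSL (γ * ModularGroup.S)).toBlocks₁₂.map ((↑) : ℤ → ℂ) *
        ((spOfSL (γ * ModularGroup.S)).toBlocks₂₂.map ((↑) : ℤ → ℂ))⁻¹) =
      (one1 (γ 0 0 * Int.sign (γ 1 0))).map ((↑) : ℤ → ℂ) := by
  obtain ⟨h12, -, h22⟩ := toBlocks_spOfSL_mul_S γ
  have hc' : ((-(γ 1 0) : ℤ) : ℂ) ≠ 0 := by exact_mod_cast (neg_ne_zero.2 hc)
  rw [h12, h22, one1_map, one1_map, one1_inv hc', one1_mul, smul_one1, one1_map]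
  congr 1
  have habs : (((γ 1 0).natAbs : ℕ) : ℂ) = ((Int.sign (γ 1 0) * γ 1 0 : ℤ) : ℂ) := by
    rw [Int.sign_mul_self_eq_natAbs, Int.cast_natCast]
  have hc0 : ((γ 1 0 : ℤ) : ℂ) ≠ 0 := by exact_mod_cast hc
  rw [habs]
  push_cast
  field_simp

/-- `BD⁻¹ = (a/c)` for `M = spOfSL (γ·S)`. -/
theorem B_mul_inv_D_eq (γ : SL(2, ℤ)) (hc : γ 1 0 ≠ 0) :
    (spOfSL (γ * ModularGroup.S)).toBlocks₁₂.map ((↑) : ℤ → ℂ) * ((spOfSL (γ * ModularGroup.S)).toBlocks₂₂.map ((↑) : ℤ → ℂ))⁻¹ =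
      one1 (((γ 0 0 : ℤ) : ℂ) / ((γ 1 0 : ℤ) : ℂ)) := by
  obtain ⟨h12, -, h22⟩ := toBlocks_spOfSL_mul_S γ
  have hc' : ((-(γ 1 0) : ℤ) : ℂ) ≠ 0 := by exact_mod_cast (neg_ne_zero.2 hc)
  rw [h12, h22, one1_map, one1_map, one1_inv hc', one1_mul]
  congr 1
  push_cast
  rw [neg_mul, inv_neg, mul_neg, neg_neg, div_eq_mul_inv]

/-- The cusp path in Siegel coordinates: `M⟨it·1⟩ = ((γ·S)·(it)) = (γ·(i/t))`. -/
theorem moeb_spOfSL_mul_S_I_smul (γ : SL(2, ℤ)) {t : ℝ} (ht : 0 < t) :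
    SiegelUpperHalfSpace.moeb ((spOfSL (γ * ModularGroup.S)).map ((↑) : ℤ → ℂ)) ((I * (t : ℂ)) • (1 : Matrix (Fin 1) (Fin 1) ℂ)) =
      one1 (((γ • (ModularGroup.S • UpperHalfPlane.ofComplex (I * t)) : ℍ) : ℂ)) := by
  have hIm : 0 < (I * t : ℂ).im := by simp [ht]
  have h1 : (I * (t : ℂ)) • (1 : Matrix (Fin 1) (Fin 1) ℂ) = one1 (((UpperHalfPlane.ofComplex (I * t) : ℍ) : ℂ)) := by
    rw [UpperHalfPlane.ofComplex_apply_of_im_pos hIm, ← SiegelModularForm.one1_one, smul_one1, mul_one]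
  rw [h1, moeb_spOfSL, mul_smul]

/-- `det(C·(it) + D) = c_δ·it + d_δ` for `M = spOfSL δ` at `Z = it·1`. -/
theorem det_denom_spOfSL_I_smul (δ : SL(2, ℤ)) {t : ℝ} (ht : 0 < t) :
    (SiegelUpperHalfSpace.denom ((spOfSL δ).map ((↑) : ℤ → ℂ)) ((I * (t : ℂ)) • (1 : Matrix (Fin 1) (Fin 1) ℂ))).det =
      ((δ 1 0 : ℤ) : ℂ) * (I * t) + ((δ 1 1 : ℤ) : ℂ) := by
  have hIm : 0 < (I * t : ℂ).im := by simp [ht]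
  have h1 : (I * (t : ℂ)) • (1 : Matrix (Fin 1) (Fin 1) ℂ) = one1 (((UpperHalfPlane.ofComplex (I * t) : ℍ) : ℂ)) := by
    rw [UpperHalfPlane.ofComplex_apply_of_im_pos hIm, ← SiegelModularForm.one1_one, smul_one1, mul_one]
  rw [h1, det_denom_spOfSL, ModularGroup.denom_apply, UpperHalfPlane.ofComplex_apply_of_im_pos hIm]

/-- The path `t ↦ S·(it) = i/t` runs into the cusp `i∞` as `t → 0⁺`. -/
theorem tendsto_S_smul_ofComplex_I_mul :
    Tendsto (fun t : ℝ => ModularGroup.S • UpperHalfPlane.ofComplex (I * t)) (𝓝[>] 0) UpperHalfPlane.atImInfty := by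
  rw [UpperHalfPlane.atImInfty, Filter.tendsto_comap_iff]
  refine tendsto_inv_nhdsGT_zero.congr' (eventually_nhdsWithin_of_forall fun t (ht : 0 < t) => ?_)
  have hIm : 0 < (I * t : ℂ).im := by simp [ht]
  rw [Function.comp_apply, UpperHalfPlane.modular_S_smul, UpperHalfPlane.im, UpperHalfPlane.coe_mk,
    UpperHalfPlane.ofComplex_apply_of_im_pos hIm]
  simp [Complex.inv_im, Complex.normSq_apply]

/-- The scalar identity behind E1: `t²(ci + d t)^{−2} · (t⁻¹ c⁻² (d·it − c)(−c))² = −c⁻²` (through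
`d·it − c = it·(c(−it)⁻¹ + d)` and `I² = −1`). PROVED. -/
theorem cuspPath_scalar (s c d t : ℂ) (hs : s ≠ 0) (hc : c ≠ 0) (ht : t ≠ 0) (hx : c * (-(I * t))⁻¹ + d ≠ 0) :
    s⁻¹ * (t⁻¹ * (c ^ 2)⁻¹ * (d * (I * t) + -c) * -c) ^ 2 * ((c * (-(I * t))⁻¹ + d) ^ 2)⁻¹ = -(s⁻¹ * (c ^ 2)⁻¹) := by
  have hIt : -(I * t) ≠ 0 := neg_ne_zero.2 (mul_ne_zero I_ne_zero ht)
  have hy : d * (I * t) + -c = I * t * (c * (-(I * t))⁻¹ + d) := by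
    field_simp
    ring
  rw [hy]
  generalize c * (-(I * t))⁻¹ + d = x at hx ⊢
  have hI : (I * t * x) ^ 2 = -(t ^ 2 * x ^ 2) := by
    rw [mul_pow, mul_pow, I_sq]; ring
  rw [show (t⁻¹ * (c ^ 2)⁻¹ * (I * t * x) * -c) ^ 2 = (t⁻¹ * (c ^ 2)⁻¹ * -c) ^ 2 * (I * t * x) ^ 2 by ring, hI]
  field_simp

/-! ## §E The analytic spine E1 → E1b → E1′ (ALL PROVED, gen 8) -/

/-- **E1 (PROVED, gen 8).** `(Θ_ij ∣₂ γ)(S·it) = −(√det[T])⁻¹ c⁻² Σ_{L : Fin 4 → Fin |c|} e{[T][L]·a/c}·Θ_P(Z′_t, W_L)`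
for `c = γ₁₀ ≠ 0`, `t > 0`, `P` the level datum.  PROOF ROUTE: `ModularForm.SL_slash_apply`, `brandtTheta_apply`,
`moeb_spOfSL_mul_S_I_smul` (backwards) to reach `siegelThetaSeries [T] (M⟨it·1⟩)`; then
`siegelThetaSeries_moeb_I_smul_eq_sum [T] (brandtGram_isSymm) (even_brandtGram_diag) (posDef_brandtGram) ⟨2, rfl⟩ hN hPQ hQP
(spOfSL_mem _) (det_toBlocks₂₂_spOfSL_mul_S ▸ …) (Int.natAbs_pos.2 hc) (natAbs_smul_B_mul_inv_D γ hc) ht` (n = 1, so `(…)^n`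
is `(…)^1`), `B_mul_inv_D_eq` under `Finset.sum_congr`; the scalar algebra: `denom(γ, S·it) = (ci + d_γ t)/t`
(`ModularGroup.denom_apply`, `modular_S_smul`), `det (denom M (it·1)) = d_γ·it − c = i(ci + d_γ t)` (`denom_fromBlocks`,
`det_one1`), `det D = −c`, whence `t²(ci+d_γ t)^{−2} · (t⁻¹ c⁻² (d_γ it − c)(−c))² = −c⁻²` (`field_simp; ring` with `I_sq`). -/
theorem slash_brandtTheta_apply_cuspPath [NeZero (Nplus * Nminus)] (i j : ClassSet S.O) (γ : SL(2, ℤ)) (hc : γ 1 0 ≠ 0)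
    {P : Matrix (Fin 4) (Fin 4) ℤ} (hPQ : P * brandtGram S i j = ((Nplus * Nminus : ℕ) : ℤ) • (1 : Matrix (Fin 4) (Fin 4) ℤ))
    (hQP : brandtGram S i j * P = ((Nplus * Nminus : ℕ) : ℤ) • (1 : Matrix (Fin 4) (Fin 4) ℤ)) {t : ℝ} (ht : 0 < t) :
    (⇑(S.brandtTheta i j) ∣[(2 : ℤ)] (γ : GL (Fin 2) ℝ)) (ModularGroup.S • UpperHalfPlane.ofComplex (I * t)) =
      -((((Real.sqrt ((brandtGram S i j).map ((↑) : ℤ → ℝ)).det : ℝ) : ℂ))⁻¹ * (((γ 1 0 : ℤ) : ℂ) ^ 2)⁻¹) *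
        ∑ L : Matrix (Fin 4) (Fin 1) (Fin (γ 1 0).natAbs),
          siegelThetaSeriesTerm (brandtGram S i j) (one1 (((γ 0 0 : ℤ) : ℂ) / ((γ 1 0 : ℤ) : ℂ))) (L.map fun x => ((x : ℕ) : ℤ)) *
            siegelJacobiTheta P (0 : Matrix (Fin 1) (Fin 4) ℂ)
              ((((Nplus * Nminus : ℕ) : ℤ) : ℂ)⁻¹ • ((-((I * (t : ℂ))⁻¹ * ((((γ 1 0).natAbs : ℕ) : ℂ) ^ 2)⁻¹)) •
                (SiegelUpperHalfSpace.denom ((spOfSL (γ * ModularGroup.S)).map ((↑) : ℤ → ℂ))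
                    ((I * (t : ℂ)) • (1 : Matrix (Fin 1) (Fin 1) ℂ)) *
                  ((spOfSL (γ * ModularGroup.S)).toBlocks₂₂.map ((↑) : ℤ → ℂ))ᵀ)))
              ((((Nplus * Nminus : ℕ) : ℤ) : ℂ)⁻¹ •
                (((((γ 1 0).natAbs : ℕ) : ℂ))⁻¹ • ((L.map fun x => ((x : ℕ) : ℤ)).map ((↑) : ℤ → ℂ))ᵀ *
                  (brandtGram S i j).map ((↑) : ℤ → ℂ))) := by
  set Q := brandtGram S i j with hQdef
  have hQ := brandtGram_isSymm S i j
  have hQe := even_brandtGram_diag S i j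
  have hQp := posDef_brandtGram S i j
  have hN : (0 : ℤ) < ((Nplus * Nminus : ℕ) : ℤ) := by exact_mod_cast Nat.pos_of_ne_zero (NeZero.ne (Nplus * Nminus))
  have hM := spOfSL_mem (γ * ModularGroup.S)
  have hD : (spOfSL (γ * ModularGroup.S)).toBlocks₂₂.det ≠ 0 := by
    rw [det_toBlocks₂₂_spOfSL_mul_S]; exact neg_ne_zero.2 hc
  have hd : 0 < (γ 1 0).natAbs := Int.natAbs_pos.2 hc
  have hdS := natAbs_smul_B_mul_inv_D γ hc
  have hIm : 0 < (I * t : ℂ).im := by simp [ht]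
  -- the point `S·(it) = (−it)⁻¹` and the automorphy factor `c(−it)⁻¹ + d ≠ 0`
  have hcoe : ((ModularGroup.S • UpperHalfPlane.ofComplex (I * t) : ℍ) : ℂ) = (-(I * t))⁻¹ := by
    rw [UpperHalfPlane.modular_S_smul, UpperHalfPlane.coe_mk, UpperHalfPlane.ofComplex_apply_of_im_pos hIm]
  have hx := UpperHalfPlane.denom_ne_zero (γ : GL (Fin 2) ℝ) (ModularGroup.S • UpperHalfPlane.ofComplex (I * t))
  rw [ModularGroup.denom_apply, hcoe] at hx
  -- expand along (4.13)–(4.14)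
  rw [← ModularForm.SL_slash, ModularForm.SL_slash_apply, ModularGroup.denom_apply, hcoe, brandtTheta_apply, ← hQdef,
    ← moeb_spOfSL_mul_S_I_smul γ ht,
    siegelThetaSeries_moeb_I_smul_eq_sum Q hQ hQe hQp ⟨2, rfl⟩ hN hPQ hQP hM hD hd hdS ht]
  simp only [B_mul_inv_D_eq γ hc]
  rw [det_denom_spOfSL_I_smul (γ * ModularGroup.S) ht, det_toBlocks₂₂_spOfSL_mul_S, (mul_S_apply γ).2.2.1,
    (mul_S_apply γ).2.2.2]
  -- scalar algebra: `t²(ci + d_γ t)^{−2} · (t⁻¹ c⁻² (d_γ it − c)(−c))² = −c⁻²`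
  have ht0 : (t : ℂ) ≠ 0 := by exact_mod_cast ht.ne'
  have hc0 : ((γ 1 0 : ℤ) : ℂ) ≠ 0 := by exact_mod_cast hc
  have hd0 : (((γ 1 0).natAbs : ℕ) : ℂ) ≠ 0 := by exact_mod_cast hd.ne'
  have hd2 : (((γ 1 0).natAbs : ℕ) : ℂ) ^ 2 = ((γ 1 0 : ℤ) : ℂ) ^ 2 := by
    rw [← Int.cast_natCast, ← Int.cast_pow, Int.natAbs_sq, Int.cast_pow]
  have hs : ((Real.sqrt (Q.map ((↑) : ℤ → ℝ)).det : ℝ) : ℂ) ≠ 0 := by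
    exact_mod_cast (Real.sqrt_pos.2 hQp.det_pos).ne'
  have hIt : (-(I * (t : ℂ))) ≠ 0 := neg_ne_zero.2 (mul_ne_zero I_ne_zero ht0)
  rw [show (4 / 2 : ℕ) = 2 from rfl, _root_.zpow_neg, zpow_ofNat, mul_right_comm]
  congr 1
  simp only [pow_one]
  push_cast
  rw [hd2]
  linear_combination cuspPath_scalar _ _ ((γ 1 1 : ℤ) : ℂ) _ hs hc0 ht0 hx


/-! ### Statements used downstream (moved here unchanged from a later section of the source so that every new `def` lands in a round-1 module; docstrings verbatim) -/

/-- B5 (gen-6 signature) as a hypothesis. -/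
def B5Statement (i j l : ClassSet S.O) : Prop :=
  ∀ c : ℕ, 0 < c → ∃ n : ℕ, n.Coprime c ∧ n ≡ 1 [MOD Nat.gcd c ((Nplus * Nminus) / Nat.gcd (Nplus * Nminus) c)] ∧
    ∃ U V : Matrix (Fin 4) (Fin 4) ℤ,
      Uᵀ * brandtGram S i j * U = (n : ℤ) • brandtGram S i l ∧ U * V = (n : ℤ) • (1 : Matrix (Fin 4) (Fin 4) ℤ)

/-- C1 (gen-6 signature) as a hypothesis. -/
def C1Statement (N : ℕ) : Prop :=
  ∀ γ γ' : SL(2, ℤ), γ 1 0 ≠ 0 → γ' 1 0 = γ 1 0 → ∀ n : ℤ, (γ 1 0 : ℤ) ∣ γ' 0 0 - n * γ 0 0 →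
    ((Nat.gcd (γ 1 0).natAbs (N / Nat.gcd N (γ 1 0).natAbs) : ℕ) : ℤ) ∣ n - 1 →
    ∃ δ ∈ CongruenceSubgroup.Gamma0 N, ∃ h : ℤ, γ' = δ * γ * ModularGroup.T ^ h
end Summit.ABC.ABC.Theorems.SteinbergCoreXi.StubIdeasK1G8

end
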